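import Literature.NumberTheory.GaloisRepresentations.IdeleTruncatedSExtOneVanishing
import Literature.NumberTheory.GaloisRepresentations.GalLayerSystemSubgroupLayers
import Literature.NumberTheory.GaloisRepresentations.IdeleCohomologySubgroups
import Literature.Algebra.Homology.DiscreteRepInflationCoinduced
import Literature.Algebra.Homology.DiscreteRepOpenSubgroupCoindRes

/-!
# `H¹(U, I_S) = 0` for every open subgroup `U ≤ G_S`: `Ext¹_{C_U}(ℤ, Res_U I_S) = 0` for Harari's `S`-truncated
# idèle limit `I_S` (Harari, *Galois Cohomology and CFT*, proof of Prop. 17.26 / Lemma 17.23; Milne ADT I Lemma 4.13)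

Topic `NumberTheory/GaloisRepresentations`; namespace `Literature.NumberTheory.GaloisRepresentations.IdeleClassBar`.
Theorems only; no definition, no named fact, no instance, no `sorry`; number fields in `Type`.  Sequel of
`IdeleTruncatedSExtOneVanishing` (-w6 g11: `I_S` is a retract of `J_{K_S} = J̄^{N_S}` in `C_{G_S}`),
`IdeleClassBarSubgroupHOne` / `GalLayerSystemSubgroupLayers` (door-c6: the vanishing transfer
`GalLayerData.ext_res_eq_zero_of_forall_subgroupImage` at an open subgroup), `IdeleCohomologySubgroups`
(`isZero_H1_res_ideleRep`: Hilbert 90 for the idèles at every subgroup of a finite layer), door-c4's Shapiro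
(`DiscreteRepOpenSubgroup.extCoindResAddEquiv`) and Hochschild–Serre edge
(`DiscreteRepInvariantsExtOneVanishing.ext_one_invariantsQuotD_eq_zero_of_infl`, -w6 g11), and
`DiscreteRepInflationCoinduced` (bsd-eis -w3 g18: `Inf Coind_U^{G_S} ℤ ≅ Coind_Ũ^{Γ_K} ℤ`).

THE MATHEMATICS (Harari, proof of Prop. 17.26 in degree 1: `H¹(G_S, I_S) = lim→_F H¹(Gal(F/k), J_{F,S}) = 0` by
Shapiro and Hilbert 90 — here at an open subgroup).  For a number field `K`, a finite set `S` of finite places,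
`G_S = Γ_K / N_S` and an open subgroup `U ≤ G_S` with preimage `Ũ ≤ Γ_K`:
`H¹(U, I_S) = Ext¹_{C_U}(ℤ, Res_U I_S)` ≅ (Shapiro) `Ext¹_{C_{G_S}}(Coind_U ℤ, I_S)` ↪ (retract)
`Ext¹_{C_{G_S}}(Coind_U ℤ, J̄^{N_S})` ← (Hochschild–Serre edge; `Coind_U ℤ` is `ℤ`-free) `Ext¹_{C_{Γ_K}}(Inf Coind_U ℤ, J̄)`
≅ (`Inf Coind_U ℤ ≅ Coind_Ũ ℤ` + Shapiro) `Ext¹_{C_Ũ}(ℤ, Res_Ũ J̄) = H¹(Ũ, J̄) = 0` — the last by the layers of the idèle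
system (`H¹(H, Res J_E) = 0` for every subgroup `H ≤ Gal(E/K)`, Hilbert 90 idèle form).

* `ext_one_res_ideleBarD_eq_zero` — **`H¹(V, J̄) = 0` for every open `V ≤ Γ_K`** (the idèle twin of door-c6's
  `ext_one_res_classBarD_eq_zero`);
* `ext_one_inflQuot_coindD_triv_ideleBarD_eq_zero`, `ext_one_coindD_triv_ideleBarKSD_eq_zero`,
  `ext_one_coindD_triv_truncIdeleBarD_eq_zero`;
* **`ext_one_triv_resD_truncIdeleBarD_eq_zero`** — `Ext¹_{C_U}(ℤ, Res_U I_S) = 0` for `U ≤ G_S` open of finite index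
  (= input [P1-mono] of -w4 g20's permutation dévissage for hypothesis (Λ2) of Milne's `Ext` road,
  `LAMBDA-E-DEVISSAGE-w4g20.md` §2), and its `OpenNormalSubgroup` form.

Cell bsd-eis, lane «PT-Ш-S-TC», brick E3 (seat bsd-line-x1-p1-w3 gen 18).  HONEST FRAMING: a vanishing statement of
classical Galois cohomology of idèles; no duality theorem and no case of BSD is proved here.

## References
* D. Harari, *Galois Cohomology and Class Field Theory*, Universitext, Springer (2020), §17.4 Lemma 17.23 and
  Proposition 17.26 (proof), §13.1 Corollary 13.2 (Hilbert 90 for idèles), Proposition 1.39 (Shapiro). [Harari2020]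
* J. S. Milne, *Arithmetic Duality Theorems*, 2nd ed. (2006), I Lemma 4.13 (proof). [MilneADT2006]
* J. W. S. Cassels, A. Fröhlich (eds.), *Algebraic Number Theory* (1967), Ch. VII (J. Tate) §7.3 Cor. 7.4.
  [CasselsFrohlichANT1967]
-/

noncomputable section

open NumberField IsDedekindDomain CategoryTheory CategoryTheory.Abelian
open Field (absoluteGaloisGroup)
open Literature.Algebra.Homology Literature.Algebra.Homology.DiscreteRep

namespace Literature.NumberTheory.GaloisRepresentations

namespace IdeleClassBar

variable {K : Type} [Field K] [NumberField K]

/-! ## §1. `H¹(V, J̄) = 0` for every open subgroup `V ≤ Γ_K` -/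

/-- **`Ext¹_{C_V}(ℤ, Res_V J̄) = 0` for every open subgroup `V ≤ Γ_K`** — Hilbert 90 for the idèle limit at an open
subgroup, from `H¹(H, Res J_E) = 0` at every subgroup `H ≤ Gal(E/K)` of every finite layer through door-c6's relative
layers (verbatim twin of `ext_one_res_classBarD_eq_zero`). [cite: Harari2020, §13.1 Corollary 13.2] -/
theorem ext_one_res_ideleBarD_eq_zero (V : Subgroup (absoluteGaloisGroup K)) (hV : IsOpen (V : Set (absoluteGaloisGroup K)))
    (x : Ext (triv (Γ := V) ℤ) ((resD ℤ V).obj (ideleBarD K)) 1) : x = 0 := by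
  refine (ideleData K).ext_res_eq_zero_of_forall_subgroupImage V hV 1 (fun E _ c => ?_) x
  haveI := E.numberField
  haveI := E.isGalois
  exact @Subsingleton.elim _ (ModuleCat.subsingleton_of_isZero
    (IdeleCohomology.isZero_H1_res_ideleRep (F := K) (E := E.1) (GalLayer.subgroupImage V E))) c 0

/-! ## §2. From `Γ_K` to `G_S`: inflation, Hochschild–Serre edge, retract -/

/-- All `ℤ`-module structures on an abelian group agree: freeness for one gives projectivity for any other
(the representation's `Module ℤ` instance versus `AddCommGroup.toIntModule`). [folklore] -/
private theorem moduleProjective_int_of_free {V : Type} [AddCommGroup V] (i j : Module ℤ V)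
    (h : @Module.Free ℤ V _ _ i) : @Module.Projective ℤ _ V _ j := by
  obtain rfl : i = j := Subsingleton.elim _ _
  exact Module.Projective.of_free

variable (K) (S : Finset (HeightOneSpectrum (𝓞 K)))
  (U : Subgroup (GaloisGroupUnramifiedOutside K (↑S : Set (HeightOneSpectrum (𝓞 K)))))
  (hU : IsOpen (U : Set (GaloisGroupUnramifiedOutside K (↑S : Set (HeightOneSpectrum (𝓞 K)))))) [U.FiniteIndex]

/-- **`Ext¹_{C_{Γ_K}}(Inf Coind_U ℤ, J̄) = 0`**: the inflated permutation module is `Coind_Ũ ℤ` (`DiscreteRepInflationCoinduced`)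
and Shapiro moves the statement to `H¹(Ũ, J̄) = 0` (§1). [cite: Harari2020, Proposition 1.39 and §13.1 Corollary 13.2] -/
theorem ext_one_inflQuot_coindD_triv_ideleBarD_eq_zero
    (e : Ext ((inflQuotFunctor ℤ (ramificationSubgroup K (↑S : Set (HeightOneSpectrum (𝓞 K))))).obj
      ((coindD ℤ U hU).obj (triv (k := ℤ) (Γ := U) ℤ))) (ideleBarD K) 1) : e = 0 := by
  haveI := DiscreteRep.finiteIndex_comapQuot (ramificationSubgroup K (↑S : Set (HeightOneSpectrum (𝓞 K)))) U
  exact DiscreteRep.ext_inflQuot_coindD_triv_eq_zero_of_forall _ U hU (ideleBarD K) 1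
    (fun z => ext_one_res_ideleBarD_eq_zero _ (DiscreteRep.isOpen_comapQuot _ U hU) z) e

/-- **`Ext¹_{C_{G_S}}(Coind_U ℤ, J_{K_S}) = 0`** (`J_{K_S} = J̄^{N_S}`; Hochschild–Serre edge for the `ℤ`-free permutation
module `Coind_U ℤ`). [cite: Harari2020, Lemma 17.23 and §4.3 Remark 4.24] -/
theorem ext_one_coindD_triv_ideleBarKSD_eq_zero
    (e : Ext ((coindD ℤ U hU).obj (triv (k := ℤ) (Γ := U) ℤ)) (ideleBarKSD K S) 1) : e = 0 := by
  haveI : @Module.Projective ℤ _ ((coindD ℤ U hU).obj (triv (k := ℤ) (Γ := U) ℤ)).obj.V _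
      ((coindD ℤ U hU).obj (triv (k := ℤ) (Γ := U) ℤ)).obj.hV2 :=
    moduleProjective_int_of_free _ _ (DiscreteRep.free_coind_triv (k := ℤ) U hU)
  exact DiscreteRep.ext_one_invariantsQuotD_eq_zero_of_infl
    (ramificationSubgroup K (↑S : Set (HeightOneSpectrum (𝓞 K)))) _ (ideleBarD K)
    (fun e' => ext_one_inflQuot_coindD_triv_ideleBarD_eq_zero K S U hU e') e

/-- **`Ext¹_{C_{G_S}}(Coind_U ℤ, I_S) = 0`** (`I_S` is a retract of `J_{K_S}` in `C_{G_S}`: `inclKSD ≫ truncKSD = 𝟙`).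
[cite: Harari2020, Proposition 17.26 (proof)] -/
theorem ext_one_coindD_triv_truncIdeleBarD_eq_zero
    (e : Ext ((coindD ℤ U hU).obj (triv (k := ℤ) (Γ := U) ℤ)) (truncIdeleBarD K S) 1) : e = 0 := by
  have h := congrArg (fun y => y.comp (Ext.mk₀ (truncKSD K S)) (add_zero 1))
    (ext_one_coindD_triv_ideleBarKSD_eq_zero K S U hU (e.comp (Ext.mk₀ (inclKSD K S)) (add_zero 1)))
  simpa only [Ext.comp_assoc_of_second_deg_zero, Ext.mk₀_comp_mk₀, inclKSD_comp_truncKSD, Ext.comp_mk₀_id,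
    Ext.zero_comp] using h

/-! ## §3. `H¹(U, I_S) = 0` -/

include hU in
/-- **`Ext¹_{C_U}(ℤ, Res_U I_S) = 0` for every open subgroup `U ≤ G_S` of finite index** (Shapiro to `C_{G_S}` and §2) —
[P1-mono] of the permutation dévissage for the localisation hypothesis (Λ2) of Milne's `Ext` road.
[cite: Harari2020, Lemma 17.23 and Proposition 17.26 (proof)] -/
theorem ext_one_triv_resD_truncIdeleBarD_eq_zero
    (y : Ext (triv (k := ℤ) (Γ := U) ℤ) ((resD ℤ U).obj (truncIdeleBarD K S)) 1) : y = 0 := by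
  obtain ⟨x, rfl⟩ := (extCoindResAddEquiv U hU (triv (k := ℤ) (Γ := U) ℤ) (truncIdeleBarD K S) 1).surjective y
  rw [ext_one_coindD_triv_truncIdeleBarD_eq_zero K S U hU x, map_zero]

omit [U.FiniteIndex] in
/-- The same for an `OpenNormalSubgroup W` of `G_S` (`G_S` is compact, so `W` has finite index).
[cite: Harari2020, Lemma 17.23 and Proposition 17.26 (proof)] -/
theorem ext_one_triv_resD_truncIdeleBarD_eq_zero_openNormal
    (W : OpenNormalSubgroup (GaloisGroupUnramifiedOutside K (↑S : Set (HeightOneSpectrum (𝓞 K)))))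
    (y : Ext (triv (k := ℤ) (Γ := (W : Subgroup (GaloisGroupUnramifiedOutside K (↑S : Set (HeightOneSpectrum (𝓞 K)))))) ℤ)
      ((resD ℤ (W : Subgroup (GaloisGroupUnramifiedOutside K (↑S : Set (HeightOneSpectrum (𝓞 K)))))).obj
        (truncIdeleBarD K S)) 1) : y = 0 := by
  haveI := Subgroup.quotient_finite_of_isOpen
    (W : Subgroup (GaloisGroupUnramifiedOutside K (↑S : Set (HeightOneSpectrum (𝓞 K))))) W.isOpen
  haveI : (W : Subgroup (GaloisGroupUnramifiedOutside K (↑S : Set (HeightOneSpectrum (𝓞 K))))).FiniteIndex :=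
    Subgroup.finiteIndex_of_finite_quotient
  exact ext_one_triv_resD_truncIdeleBarD_eq_zero K S
    (W : Subgroup (GaloisGroupUnramifiedOutside K (↑S : Set (HeightOneSpectrum (𝓞 K))))) W.isOpen y

end IdeleClassBar

end Literature.NumberTheory.GaloisRepresentations

end
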